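import Literature.AlgebraicGeometry.Motives.SeesawSubscheme
import HarnessLib

/-!
# M13 (Poincaré universality), node N1: the seesaw closed subscheme for an abelian variety — `stub_M13_1_seesawSubscheme`

The statement `stub_M13_1_seesawSubscheme` of the M13 grand assembly (`ResidualStatement` / `GraphCondition` chain),
token for token, discharged by the generic seesaw closed subscheme `SeesawSubscheme.exists_seesawSubscheme'`
([MumfordAV1970] §10 p. 89; [GortzWedhorn2023] Thm. 24.66) at `X := A₀.X` (proper and geometrically integral) with the
unit section as base point: for a complex abelian variety `A₀`, `W/ℂ` locally of finite type and a rank-one module `𝓕`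
on `A₀ × W`, there is a closed subscheme `Z ↪ W` such that `u : S → W` factors through `Z` iff `(1 × u)^*𝓕 ≅ pr_S^*𝓜`
for a rank-one `𝓜` on `S`.  No hypothesis beyond Mathlib and the tree (cell `hodgecm-mathlib`, M13 tranche N1).

## References
* [MumfordAV1970] D. Mumford, *Abelian Varieties* (1970), §10 p. 89.
* [GortzWedhorn2023] U. Görtz, T. Wedhorn, *Algebraic Geometry II* (2023), Thm. 24.66 (p. 405; proof pp. 407–408).
-/

set_option autoImplicit false

noncomputable section

open CategoryTheory CategoryTheory.Limits AlgebraicGeometry MonoidalCategory CartesianMonoidalCategory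

namespace Literature.AlgebraicGeometry.Motives.AbelianVariety

open SeesawSubscheme

variable (A₀ : AbelianVariety ℂ)

/-- **(M13-1) THE SCHEME-THEORETIC SEESAW over a possibly NON-REDUCED base** ([GortzWedhorn2023] Thm. 24.66, for
`pr : A₀ × W → W`, `W` locally of finite type over `ℂ`, `𝓕` of rank one on `A₀ × W`): there is a closed subscheme `Z ↪ W`
such that a `ℂ`-morphism `u : S → W` factors through `Z` iff `(1 × u)^*𝓕 ≅ pr_S^*𝓜` for some rank-one `𝓜` on `S`.
[cite: GortzWedhorn2023, Thm. 24.66 (p. 405; proof pp. 407–408)] [cite: MumfordAV1970, §10 (p. 89)] -/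
theorem stub_M13_1_seesawSubscheme_holds (W : SchemeOver ℂ) [LocallyOfFiniteType W.hom]
    (𝓕 : (A₀.X ⊗ W).left.Modules) (h𝓕 : HasRank 𝓕 1) :
    ∃ (Z : SchemeOver ℂ) (i : Z ⟶ W) (_ : IsClosedImmersion i.left),
      ∀ (S : SchemeOver ℂ) (u : S ⟶ W),
        (∃ v : S ⟶ Z, v ≫ i = u) ↔
          ∃ (𝓜 : S.left.Modules) (_ : HasRank 𝓜 1),
            Nonempty ((Scheme.Modules.pullback (A₀.X ◁ u).left).obj 𝓕 ≅
              (Scheme.Modules.pullback (CartesianMonoidalCategory.snd A₀.X S).left).obj 𝓜) :=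
  exists_seesawSubscheme' A₀.X (MonObj.one : 𝟙_ (SchemeOver ℂ) ⟶ A₀.X) W 𝓕 h𝓕

end Literature.AlgebraicGeometry.Motives.AbelianVariety

end
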